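import Literature.Probability.Percolation.CentralFiveArmIndex
import HarnessLib

/-!
# The central five-arm site, II: trunk indices, the seal lemma, and the five arms reaching the arena's sides

Topic `Literature/Probability/Percolation`; family `crit-perc`. PROOFS ONLY (no definition of a
named fact). Second brick of the separation-free proof of the near-critical a priori lower bound
of the ALTERNATING four-arm probability, `π̂^alt_t(m, n) ≥ c (m/n)^{2-β}` below `L(t)`
(W. Werner, PCMI 2009, Lecture 6, §3; P. Nolin, EJP 13 (2008), Thm. 24 (ii), Thm. 27
[arXiv 0711.4948: Thm. 23 (ii), Thm. 26]) — the hypothesis `hLB` of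
`Nolin2008_thm27_oneArm_of_altHyps` and of `Werner2009_oneArm_logDeriv_of_altSeparation`.

## The construction (Nolin's five-arm site, made central)

As in `FiveArmArms.lean` (Nolin 2008, proof of Thm. 24 (ii), arXiv p. 17: the lowest open
crossing `κ` of a parallelogram, an open and a closed path from the top side landing on `κ`, the
last open foot `v` before a closed one), but the parallelogram `R(M, N)` is now a tall central
column of a wider ARENA `[-W_L, M + W_R] × [0, N]`, and four of the five arms of `v` are
continued to the four sides of the arena:

* three paths from the top side land on `κ` — closed in the column `[a₂, b₂]`, open in
  `[a₁, b₁]`, closed in `[a₃, b₃]` (feet `f₂, f₁, f₃`); the double foot `i` between `f₁` and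
  `f₃` (`LowSeq.exists_doubleFoot'`, `FiveArmSite.lean`) is the site `v = κ i`, with an open and
  a closed arm to the top side;
* two open TRUNKS — a horizontal crossing of `[-W_L, w_L] × [H+1, Y_V]` entering `R` from the far
  left, met by an open path of `[0, w_L] × [B_V, Y_V]` off the explored set descending to a
  neighbour of `κ k_L` (and symmetrically on the right, `κ k_R`) — continue the two halves of `κ`
  to the far sides `x = -W_L`, `x = M + W_R`;
* two closed SEALS — crossings of `[0, b_S] × [Y₁, Y₁ + h_S]` and `[a_S, M] × [Y₁, Y₁ + h_S]`
  above the trunks, meeting the closed columns — keep the trunks away from every open path of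
  the region above that reaches the top side (`seal_left`, `seal_right`: corner crossing lemma);
* the index inequalities `k_L < min(f₁, f₂, f₃)`, `max(f₁, f₂, f₃) < k_R` (`trunk_index_le`,
  `trunk_index_ge`: the trunk structure is a left–right crossing of the arena, a foot with its
  column and the closed cluster below `κ` a top–bottom one; strictness from the column positions)
  place the trunks' landings on the correct halves `κ[0, i)`, `κ(i, n]`;
* the closed arm below `v` is the closed cluster of the bottom side of `R`, reaching `y = 0`.

`exists_centralFiveArms` records the outcome: the site `v` (open, explored, at height `≥ B₀`)
and five sets — `S_L, S_R` (open, through the two halves of `κ` and the trunks, every site joined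
inside the set to a site of the far left/right side), `S_U` (closed, to the top side), `S_D`
(closed, to the bottom side), `S_5` (open, to the top side) — each containing a neighbour of `v`,
with `S_5` disjoint from `S_L ∪ S_R`, `S_L ∩ S_R = ∅`, `S_U ∩ S_D = ∅`. Since the four arms
`S_L, S_U, S_R, S_D` end on the four sides of the arena, the alternation of colours around `v`
will be certified (`CentralFiveArmCert.lean`) by the crossing lemma in the arena, uniformly in
the position of `v` — this is the point of the construction.

## References

* P. Nolin, Near-critical percolation in two dimensions, *Electron. J. Probab.* 13 (2008)
  1562–1623, §5.2, proof of Thm. 24 (ii) (arXiv 0711.4948: Thm. 23 (ii), p. 17) [Nolin2008].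
* W. Werner, *Lectures on two-dimensional critical percolation*, IAS/Park City Math. Ser. 16
  (2009), Lecture 6, §3; first exercise sheet, "Five-arm exponent", 3 ("two of the `K` clusters
  are adjacent, and only touch inside `Λ_{m/2}`") [WernerPCMI2009].
* H. Kesten, *Percolation theory for mathematicians*, Birkhäuser (1982), §2.2–2.3 [KestenPTM1982].

## Mathlib / tree

Tree: `LowSeq`, `SimpleSeq`, `aboveSet`, `IsFootO`, `IsFootK`, `LowSeq.exists_eq_of_adj_aboveSet`,
`LowSeq.not_mem_aboveSet`, `mem_aboveSet_of_pathIn`, `mem_aboveSet_of_mem_topSide`,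
`mem_rectangle_of_mem_aboveSet`, `exists_simpleSeq_of_pathIn` (`FiveArmFrontier.lean`),
`LowSeq.exists_doubleFoot'` (`FiveArmSite.lean`), `LowSeq.exists_foot_of_pathIn`
(`FiveArmArms.lean`), `PathIn.pathIn_cluster`, `exists_lr_subset_explored`, `mem_explored`,
`mem_botCluster`, `botCluster_subset(_explored)`, `explored_subset` (`TriLowestCrossingSwitch.lean`),
`band_meet`, `corner_meet_left/right`, `pathIn_line` (`CentralFiveArmIndex.lean`),
`PathIn.tri_crossings_meet` (`TriCrossingsMeet.lean`), `triStrip` (`TriRSWChaining.lean`).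
-/

noncomputable section

open Set

namespace Literature.Probability.Percolation

open LatticeModels

variable {M N : ℕ} {ω : Set (Site 2)}

/-! ### Clusters of a set, as supports -/

/-- Two sites of the `A`-cluster of `x` are joined inside that cluster. [folklore] -/
theorem pathIn_cluster_of_mem {A : Set (Site 2)} {x z w : Site 2} (hz : PathIn triGraph A x z)
    (hw : PathIn triGraph A x w) : PathIn triGraph {q | PathIn triGraph A x q} z w :=
  hz.pathIn_cluster.symm.trans hw.pathIn_cluster

namespace LowSeq

variable {κ : ℕ → Site 2} {n : ℕ}

/-- A site of the lowest crossing off the bottom side has a closed neighbour in the closed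
cluster of the bottom side, joined to the bottom side by a closed path of `R`. [cite: KestenPTM1982, §2.3 (the lowest crossing bounds the region below it)] -/
theorem exists_botCluster_adj (h : LowSeq M N ω κ n) {k : ℕ} (hk : k ≤ n) (hrow : 1 ≤ κ k 1) :
    ∃ c b : Site 2, c ∈ botCluster M N ω ∧ triGraph.Adj c (κ k) ∧ b 1 = 0 ∧
      PathIn triGraph (↑(rectangle M N) ∩ ωᶜ) b c := by
  have hv := h.mem hk
  obtain ⟨-, hcase⟩ := mem_explored.1 hv.1
  rcases hcase with hb | ⟨c, hc, hc' | hci⟩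
  · have := (mem_coe_bottomSide.1 (Finset.mem_coe.2 hb)).2; omega
  · exact absurd hv.2.1 (hc' ▸ (botCluster_subset hc).2)
  · obtain ⟨b, hb, hbc⟩ := mem_botCluster.1 hc
    exact ⟨c, b, hc, hci, (mem_coe_bottomSide.1 (Finset.mem_coe.2 hb)).2, hbc⟩

/-! ### The trunk indices -/

/-- **The left trunk lands before every foot.** Let `κ` run from the left to the right side. Let
`T_L` be a set of open unexplored sites of the arena `[-W_L, M] × [0, N]` containing a path from a
site `x_L` of the far left side to a neighbour `g_L` of `κ k_L`. Let `f` be a foot: `κ f` (off the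
bottom side) has a neighbour `u_f` joined to the top side by a path of a set `C_f` of the region
above which avoids `T_L`. Then `k_L ≤ f`: the left–right crossing
`x_L → g_L → κ k_L → ⋯ → κ n` of the arena meets the top–bottom crossing
`top → u_f → κ f → (closed cluster of the bottom side) → bottom`, and the only possible common
site is `κ f = κ m` with `m ≥ k_L`. [cite: KestenPTM1982, §2.2 (paths crossing a rectangle must intersect)] [cite: Nolin2008, §5.2, proof of Thm. 24 (ii) (arXiv 0711.4948: p. 17)] -/
theorem trunk_index_le (h : LowSeq M N ω κ n) (hn : κ n 0 = M) {WL : ℕ}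
    {TL : Set (Site 2)} (hTLbox : ∀ z ∈ TL, -(WL : ℤ) ≤ z 0 ∧ z 0 ≤ M ∧ 0 ≤ z 1 ∧ z 1 ≤ N)
    (hTLexp : ∀ z ∈ TL, z ∉ explored M N ω) (hTLω : TL ⊆ ω) {xL gL : Site 2} (hxL : xL 0 = -(WL : ℤ))
    (hpath : PathIn triGraph TL xL gL) {kL : ℕ} (hkL : kL ≤ n) (hadjL : triGraph.Adj gL (κ kL))
    {f : ℕ} (hf : f ≤ n) (hrow : 1 ≤ κ f 1) {uf tf : Site 2} (huf : triGraph.Adj (κ f) uf)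
    (htf : tf ∈ topSide M N) {Cf : Set (Site 2)} (hCf : Cf ⊆ aboveSet M N ω)
    (hpf : PathIn triGraph Cf uf tf) (hdisj : ∀ z ∈ TL, z ∉ Cf) : kL ≤ f := by
  obtain ⟨c, b, hc, hcf, hb, hbc⟩ := h.exists_botCluster_adj hf hrow
  -- the top–bottom crossing through `κ f`
  set BC : Set (Site 2) := {z | PathIn triGraph (↑(rectangle M N) ∩ ωᶜ) c z} with hBC
  set A' : Set (Site 2) := BC ∪ {κ f} ∪ Cf with hA'
  have hTB : PathIn triGraph A' b tf := by
    have h1 : PathIn triGraph A' b c :=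
      (hbc.symm.pathIn_cluster.symm).mono fun z hz => Or.inl (Or.inl hz)
    have h2 : PathIn triGraph A' c (κ f) :=
      PathIn.of_adj (Or.inl (Or.inl (PathIn.refl hbc.right_mem))) (Or.inl (Or.inr rfl)) hcf
    have h3 : PathIn triGraph A' (κ f) uf := PathIn.of_adj (Or.inl (Or.inr rfl)) (Or.inr hpf.left_mem) huf
    exact ((h1.trans h2).trans h3).trans (hpf.mono fun z hz => Or.inr hz)
  -- the left–right crossing through the trunk and `κ[kL, n]`
  set K : Set (Site 2) := {z | ∃ m, m ≤ n ∧ kL ≤ m ∧ κ m = z} with hK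
  set A : Set (Site 2) := TL ∪ K with hA
  have hLR : PathIn triGraph A xL (κ n) := by
    have h1 : PathIn triGraph A xL gL := hpath.mono subset_union_left
    have h2 : PathIn triGraph A gL (κ kL) :=
      PathIn.of_adj (Or.inl hpath.right_mem) (Or.inr ⟨kL, hkL, le_rfl, rfl⟩) hadjL
    have h3 : PathIn triGraph A (κ kL) (κ n) :=
      (h.seq.pathIn_seg hkL le_rfl fun m hm hmn => (⟨m, hmn, hm, rfl⟩ : κ m ∈ K)).mono subset_union_right
    exact (h1.trans h2).trans h3
  -- bounds
  have hAbox : ∀ z ∈ A, -(WL : ℤ) ≤ z 0 ∧ z 0 ≤ M ∧ 0 ≤ z 1 ∧ z 1 ≤ N := by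
    rintro z (hz | ⟨m, hm, -, rfl⟩)
    · exact hTLbox z hz
    · have := mem_coe_rectangle.1 (Finset.mem_coe.2 (h.mem hm).2.2); omega
  have hA'box : ∀ z ∈ A', -(WL : ℤ) ≤ z 0 ∧ z 0 ≤ M ∧ 0 ≤ z 1 ∧ z 1 ≤ N := by
    have hR : A' ⊆ ↑(rectangle M N) := by
      rintro z ((hz | hz) | hz)
      · exact hz.right_mem.1
      · rw [mem_singleton_iff.1 hz]; exact Finset.mem_coe.2 (h.mem hf).2.2
      · exact aboveSet_subset_rectangle (hCf hz)
    intro z hz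
    have := mem_coe_rectangle.1 (hR hz); omega
  obtain ⟨z, hzA, hzA'⟩ := PathIn.tri_crossings_meet (L := -(WL : ℤ)) (R := M) (B := 0) (T := N)
    hAbox hA'box hLR hxL hn hTB hb (mem_coe_topSide.1 (Finset.mem_coe.2 htf)).2
  -- the common site is `κ f = κ m`, `m ≥ kL`
  rcases hzA with hz | ⟨m, hm, hkm, rfl⟩
  · exfalso
    rcases hzA' with (hz' | hz') | hz'
    · exact hz'.right_mem.2 (hTLω hz)
    · exact hTLexp z hz (mem_singleton_iff.1 hz' ▸ (h.mem hf).1)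
    · exact hdisj z hz hz'
  · rcases hzA' with (hz' | hz') | hz'
    · exact absurd (h.mem hm).2.1 hz'.right_mem.2
    · have := h.seq.inj m f hm hf (mem_singleton_iff.1 hz'); omega
    · exact absurd (hCf hz') (h.not_mem_aboveSet hm)

/-- **The right trunk lands after every foot**: the mirror statement, with a set `T_R` of open
unexplored sites of `[0, M + W_R] × [0, N]` containing a path from a site of the far right side
to a neighbour of `κ k_R`; then `f ≤ k_R` (the left–right crossing is now
`κ 0 → ⋯ → κ k_R → g_R → x_R`). [cite: KestenPTM1982, §2.2 (paths crossing a rectangle must intersect)] [cite: Nolin2008, §5.2, proof of Thm. 24 (ii) (arXiv 0711.4948: p. 17)] -/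
theorem trunk_index_ge (h : LowSeq M N ω κ n) (h0 : κ 0 0 = 0) {WR : ℕ}
    {TR : Set (Site 2)} (hTRbox : ∀ z ∈ TR, (0 : ℤ) ≤ z 0 ∧ z 0 ≤ M + WR ∧ 0 ≤ z 1 ∧ z 1 ≤ N)
    (hTRexp : ∀ z ∈ TR, z ∉ explored M N ω) (hTRω : TR ⊆ ω) {xR gR : Site 2} (hxR : xR 0 = M + WR)
    (hpath : PathIn triGraph TR xR gR) {kR : ℕ} (hkR : kR ≤ n) (hadjR : triGraph.Adj gR (κ kR))
    {f : ℕ} (hf : f ≤ n) (hrow : 1 ≤ κ f 1) {uf tf : Site 2} (huf : triGraph.Adj (κ f) uf)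
    (htf : tf ∈ topSide M N) {Cf : Set (Site 2)} (hCf : Cf ⊆ aboveSet M N ω)
    (hpf : PathIn triGraph Cf uf tf) (hdisj : ∀ z ∈ TR, z ∉ Cf) : f ≤ kR := by
  obtain ⟨c, b, hc, hcf, hb, hbc⟩ := h.exists_botCluster_adj hf hrow
  set BC : Set (Site 2) := {z | PathIn triGraph (↑(rectangle M N) ∩ ωᶜ) c z} with hBC
  set A' : Set (Site 2) := BC ∪ {κ f} ∪ Cf with hA'
  have hTB : PathIn triGraph A' b tf := by
    have h1 : PathIn triGraph A' b c :=
      (hbc.symm.pathIn_cluster.symm).mono fun z hz => Or.inl (Or.inl hz)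
    have h2 : PathIn triGraph A' c (κ f) :=
      PathIn.of_adj (Or.inl (Or.inl (PathIn.refl hbc.right_mem))) (Or.inl (Or.inr rfl)) hcf
    have h3 : PathIn triGraph A' (κ f) uf := PathIn.of_adj (Or.inl (Or.inr rfl)) (Or.inr hpf.left_mem) huf
    exact ((h1.trans h2).trans h3).trans (hpf.mono fun z hz => Or.inr hz)
  set K : Set (Site 2) := {z | ∃ m, m ≤ n ∧ m ≤ kR ∧ κ m = z} with hK
  set A : Set (Site 2) := TR ∪ K with hA
  have hLR : PathIn triGraph A (κ 0) xR := by
    have h1 : PathIn triGraph A (κ 0) (κ kR) :=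
      (h.seq.pathIn_seg (Nat.zero_le _) hkR fun m _ hm => (⟨m, hm.trans hkR, hm, rfl⟩ : κ m ∈ K)).mono
        subset_union_right
    have h2 : PathIn triGraph A (κ kR) gR :=
      PathIn.of_adj (Or.inr ⟨kR, hkR, le_rfl, rfl⟩) (Or.inl hpath.right_mem) hadjR.symm
    exact (h1.trans h2).trans (hpath.symm.mono subset_union_left)
  have hAbox : ∀ z ∈ A, (0 : ℤ) ≤ z 0 ∧ z 0 ≤ M + WR ∧ 0 ≤ z 1 ∧ z 1 ≤ N := by
    rintro z (hz | ⟨m, hm, -, rfl⟩)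
    · exact hTRbox z hz
    · have := mem_coe_rectangle.1 (Finset.mem_coe.2 (h.mem hm).2.2); omega
  have hA'box : ∀ z ∈ A', (0 : ℤ) ≤ z 0 ∧ z 0 ≤ M + WR ∧ 0 ≤ z 1 ∧ z 1 ≤ N := by
    have hR : A' ⊆ ↑(rectangle M N) := by
      rintro z ((hz | hz) | hz)
      · exact hz.right_mem.1
      · rw [mem_singleton_iff.1 hz]; exact Finset.mem_coe.2 (h.mem hf).2.2
      · exact aboveSet_subset_rectangle (hCf hz)
    intro z hz
    have := mem_coe_rectangle.1 (hR hz); omega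
  obtain ⟨z, hzA, hzA'⟩ := PathIn.tri_crossings_meet (L := 0) (R := (M : ℤ) + WR) (B := 0) (T := N)
    hAbox hA'box hLR h0 hxR hTB hb (mem_coe_topSide.1 (Finset.mem_coe.2 htf)).2
  rcases hzA with hz | ⟨m, hm, hkm, rfl⟩
  · exfalso
    rcases hzA' with (hz' | hz') | hz'
    · exact hz'.right_mem.2 (hTRω hz)
    · exact hTRexp z hz (mem_singleton_iff.1 hz' ▸ (h.mem hf).1)
    · exact hdisj z hz hz'
  · rcases hzA' with (hz' | hz') | hz'
    · exact absurd (h.mem hm).2.1 hz'.right_mem.2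
    · have := h.seq.inj m f hm hf (mem_singleton_iff.1 hz'); omega
    · exact absurd (hCf hz') (h.not_mem_aboveSet hm)

/-! ### The seal lemma -/

/-- **The seal lemma, left side.** Suppose a closed path crosses `[0, b_S] × [Y₁, Y₁ + h_S]`
from the left side of `R` to the column `x = b_S`, and a closed path of the region above, inside
the columns `[0, b_S]`, descends from the top side to a neighbour `g₂` (of height `≤ Y₁`) of a
site `κ f₂` of the lowest crossing off the bottom side. Let `T_L` be a set of open unexplored
sites of the arena `[-W_L, M] × [0, N]`, all of height `< Y₁`, every site of which is joined
inside `T_L` to a site `x_L` of the far left side. Then NO site of `T_L` is joined to the top side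
by an open path of the region above: such a path, preceded by the trunk, is a path from a low
point of the far left side to the top side, and it would have to meet (`corner_meet_left`) the
path from the higher point `(-W_L, y)` of the far left side along the row `y` of the seal's left
end, the seal, the closed column, `κ f₂` and the closed cluster of the bottom side down to the
bottom side — but these two share no site. [cite: KestenPTM1982, §2.2 (paths crossing a rectangle must intersect)] [cite: WernerPCMI2009, first exercise sheet, "Five-arm exponent", 3 (clusters that only touch inside)] -/
theorem seal_left (h : LowSeq M N ω κ n) {WL hs bS : ℕ} {Y₁ : ℤ} (hY₁ : 0 ≤ Y₁) (hY₁N : Y₁ + hs ≤ N)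
    {xβ yβ : Site 2} (hxβ : xβ 0 = 0) (hyβ : yβ 0 = bS)
    (hβ : PathIn triGraph (triStrip 0 Y₁ bS hs ∩ ωᶜ) xβ yβ) (hbSM : (bS : ℤ) ≤ M)
    {f₂ : ℕ} (hf₂ : f₂ ≤ n) (hrow : 1 ≤ κ f₂ 1) {g₂ t₂ : Site 2} (hg₂ : triGraph.Adj (κ f₂) g₂)
    (hg₂row : g₂ 1 ≤ Y₁) (ht₂ : t₂ ∈ topSide M N) {C₂ : Set (Site 2)}
    (hC₂ : C₂ ⊆ aboveSet M N ω ∩ ωᶜ) (hC₂col : ∀ z ∈ C₂, 0 ≤ z 0 ∧ z 0 ≤ bS)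
    (hp₂ : PathIn triGraph C₂ g₂ t₂)
    {TL : Set (Site 2)} (hTLbox : ∀ z ∈ TL, -(WL : ℤ) ≤ z 0 ∧ z 0 ≤ M ∧ 0 ≤ z 1 ∧ z 1 < Y₁)
    (hTLexp : ∀ z ∈ TL, z ∉ explored M N ω) (hTLω : TL ⊆ ω) {xL : Site 2} (hxL : xL 0 = -(WL : ℤ))
    (hTLconn : ∀ q ∈ TL, PathIn triGraph TL xL q) :
    ∀ q ∈ TL, ∀ t ∈ topSide M N, ¬ PathIn triGraph (aboveSet M N ω ∩ ω) q t := by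
  intro q hq t ht hqt
  have ht1 : t 1 = N := (mem_coe_topSide.1 (Finset.mem_coe.2 ht)).2
  have ht₂1 : t₂ 1 = N := (mem_coe_topSide.1 (Finset.mem_coe.2 ht₂)).2
  -- the path `Π`: far left (low) → q → top
  set APi : Set (Site 2) := TL ∪ (aboveSet M N ω ∩ ω) with hAPi
  have hPi : PathIn triGraph APi xL t :=
    ((hTLconn q hq).mono subset_union_left).trans (hqt.mono subset_union_right)
  have hxL1 : xL 1 < Y₁ := (hTLbox xL (hTLconn q hq).left_mem).2.2.2
  -- the seal meets the closed column
  set BL : Set (Site 2) := {z | PathIn triGraph (triStrip 0 Y₁ bS hs ∩ ωᶜ) xβ z} with hBL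
  set P2 : Set (Site 2) := {z | PathIn triGraph C₂ g₂ z} with hP2
  obtain ⟨m₂, hm₂P, hm₂B⟩ : ∃ m, m ∈ P2 ∧ m ∈ BL := by
    refine band_meet (L := 0) (R := (bS : ℤ)) (b₀ := Y₁) (b₁ := Y₁ + hs) (by omega) (Aξ := BL) (A := P2)
      (fun z hz => ?_) hβ.pathIn_cluster hxβ hyβ (fun z hz => hC₂col z hz.right_mem)
      hp₂.pathIn_cluster hg₂row (by rw [ht₂1]; exact hY₁N)
    have := mem_triStrip.1 hz.right_mem.1; omega
  -- the closed cluster below `κ f₂`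
  obtain ⟨c, b, -, hcf, hb, hbc⟩ := h.exists_botCluster_adj hf₂ hrow
  set BC : Set (Site 2) := {z | PathIn triGraph (↑(rectangle M N) ∩ ωᶜ) c z} with hBC
  -- the row extension to the far left side (strictly left of `R`)
  set Ext : Set (Site 2) := {z | z 1 = xβ 1 ∧ -(WL : ℤ) ≤ z 0 ∧ z 0 ≤ -1} with hExt
  set cc : Site 2 := xβ + (WL : ℤ) • -triE0 with hcc
  have hcc0 : cc 0 = -(WL : ℤ) := by rw [hcc, (ray_neg_triE0_apply _ _).1, hxβ]; ring
  have hcc1 : cc 1 = xβ 1 := by rw [hcc, (ray_neg_triE0_apply _ _).2]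
  -- the path `Σ`: far left (high) → seal → column → κ f₂ → bottom
  set ASig : Set (Site 2) := Ext ∪ BL ∪ P2 ∪ {κ f₂} ∪ BC with hASig
  have hSig : PathIn triGraph ASig cc b := by
    have h1 : PathIn triGraph ASig cc xβ := by
      have : PathIn triGraph ASig cc (cc + (WL : ℤ) • triE0) := by
        refine pathIn_line triGraph_adj_add_triE0 cc WL fun j hj => ?_
        rcases eq_or_lt_of_le hj with heq | hlt
        · have e : cc + ((WL : ℕ) : ℤ) • triE0 = xβ := by rw [hcc]; ext i; fin_cases i <;> simp
          rw [heq, e]; exact Or.inl (Or.inl (Or.inl (Or.inr (PathIn.refl hβ.left_mem))))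
        · refine Or.inl (Or.inl (Or.inl (Or.inl ⟨by simp [hcc1], by simp [hcc0], ?_⟩)))
          simp [hcc0]; omega
      have e : cc + (WL : ℤ) • triE0 = xβ := by rw [hcc]; ext i; fin_cases i <;> simp
      rwa [e] at this
    have h2 : PathIn triGraph ASig xβ m₂ :=
      (hm₂B.pathIn_cluster).mono fun z hz => Or.inl (Or.inl (Or.inl (Or.inr hz)))
    have h3 : PathIn triGraph ASig m₂ g₂ :=
      (pathIn_cluster_of_mem hm₂P (PathIn.refl hp₂.left_mem)).mono fun z hz => Or.inl (Or.inl (Or.inr hz))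
    have h4 : PathIn triGraph ASig g₂ (κ f₂) :=
      PathIn.of_adj (Or.inl (Or.inl (Or.inr (PathIn.refl hp₂.left_mem)))) (Or.inl (Or.inr rfl)) hg₂.symm
    have h5 : PathIn triGraph ASig (κ f₂) c :=
      PathIn.of_adj (Or.inl (Or.inr rfl)) (Or.inr (PathIn.refl hbc.right_mem)) hcf.symm
    exact ((((h1.trans h2).trans h3).trans h4).trans h5).trans
      ((hbc.symm.pathIn_cluster).mono fun z hz => Or.inr hz)
  -- bounds in the arena `[-WL, M] × [0, N]`
  have hAPibox : ∀ z ∈ APi, -(WL : ℤ) ≤ z 0 ∧ z 0 ≤ M ∧ 0 ≤ z 1 ∧ z 1 ≤ N := by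
    rintro z (hz | hz)
    · have := hTLbox z hz; omega
    · have := mem_coe_rectangle.1 (aboveSet_subset_rectangle hz.1); omega
  have hxβs := mem_triStrip.1 hβ.left_mem.1
  have hASigbox : ∀ z ∈ ASig, -(WL : ℤ) ≤ z 0 ∧ z 0 ≤ M ∧ 0 ≤ z 1 ∧ z 1 ≤ N := by
    rintro z ((((⟨h1, h2, h3⟩ | hz) | hz) | hz) | hz)
    · omega
    · have := mem_triStrip.1 hz.right_mem.1; omega
    · have := mem_coe_rectangle.1 (aboveSet_subset_rectangle (hC₂ hz.right_mem).1); omega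
    · rw [mem_singleton_iff.1 hz]
      have := mem_coe_rectangle.1 (Finset.mem_coe.2 (h.mem hf₂).2.2); omega
    · have := mem_coe_rectangle.1 hz.right_mem.1; omega
  obtain ⟨z, hzPi, hzSig⟩ := corner_meet_left (L := -(WL : ℤ)) (R := M) (B := 0) (T := N) hAPibox hASigbox
    hPi hxL ht1 hSig hcc0 hb (by rw [hcc1]; omega)
  -- no common site
  rcases hzPi with hz | ⟨hzA, hzω⟩
  · rcases hzSig with ((((⟨h1, h2, h3⟩ | hz') | hz') | hz') | hz')
    · have := hTLbox z hz; omega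
    · exact hz'.right_mem.2 (hTLω hz)
    · exact (hC₂ hz'.right_mem).2 (hTLω hz)
    · exact hTLexp z hz (mem_singleton_iff.1 hz' ▸ (h.mem hf₂).1)
    · exact hz'.right_mem.2 (hTLω hz)
  · rcases hzSig with ((((⟨h1, h2, h3⟩ | hz') | hz') | hz') | hz')
    · have := mem_coe_rectangle.1 (aboveSet_subset_rectangle hzA); omega
    · exact hz'.right_mem.2 hzω
    · exact (hC₂ hz'.right_mem).2 hzω
    · exact (mem_rectangle_of_mem_aboveSet hzA).2 (mem_singleton_iff.1 hz' ▸ (h.mem hf₂).1)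
    · exact hz'.right_mem.2 hzω


/-- **The seal lemma, right side**: the mirror statement for a closed crossing of
`[a_S, M] × [Y₁, Y₁ + h_S]`, a closed column inside the columns `[a_S, M]`, and a set `T_R` of
open unexplored sites of `[0, M + W_R] × [0, N]` of height `< Y₁` joined inside `T_R` to a site
of the far right side (`corner_meet_right`). [cite: KestenPTM1982, §2.2 (paths crossing a rectangle must intersect)] [cite: WernerPCMI2009, first exercise sheet, "Five-arm exponent", 3 (clusters that only touch inside)] -/
theorem seal_right (h : LowSeq M N ω κ n) {WR hs : ℕ} {Y₁ aS : ℤ} (hY₁ : 0 ≤ Y₁) (hY₁N : Y₁ + hs ≤ N)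
    (haS : 0 ≤ aS) (haSM : aS ≤ M) {xβ yβ : Site 2} (hxβ : xβ 0 = aS) (hyβ : yβ 0 = M)
    (hβ : PathIn triGraph (triStrip aS Y₁ (M - aS).toNat hs ∩ ωᶜ) xβ yβ)
    {f₃ : ℕ} (hf₃ : f₃ ≤ n) (hrow : 1 ≤ κ f₃ 1) {g₃ t₃ : Site 2} (hg₃ : triGraph.Adj (κ f₃) g₃)
    (hg₃row : g₃ 1 ≤ Y₁) (ht₃ : t₃ ∈ topSide M N) {C₃ : Set (Site 2)}
    (hC₃ : C₃ ⊆ aboveSet M N ω ∩ ωᶜ) (hC₃col : ∀ z ∈ C₃, aS ≤ z 0 ∧ z 0 ≤ M)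
    (hp₃ : PathIn triGraph C₃ g₃ t₃)
    {TR : Set (Site 2)} (hTRbox : ∀ z ∈ TR, (0 : ℤ) ≤ z 0 ∧ z 0 ≤ M + WR ∧ 0 ≤ z 1 ∧ z 1 < Y₁)
    (hTRexp : ∀ z ∈ TR, z ∉ explored M N ω) (hTRω : TR ⊆ ω) {xR : Site 2} (hxR : xR 0 = M + WR)
    (hTRconn : ∀ q ∈ TR, PathIn triGraph TR xR q) :
    ∀ q ∈ TR, ∀ t ∈ topSide M N, ¬ PathIn triGraph (aboveSet M N ω ∩ ω) q t := by
  intro q hq t ht hqt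
  have ht1 : t 1 = N := (mem_coe_topSide.1 (Finset.mem_coe.2 ht)).2
  have ht₃1 : t₃ 1 = N := (mem_coe_topSide.1 (Finset.mem_coe.2 ht₃)).2
  have hMaS : (((M : ℤ) - aS).toNat : ℤ) = M - aS := Int.toNat_of_nonneg (by omega)
  set APi : Set (Site 2) := TR ∪ (aboveSet M N ω ∩ ω) with hAPi
  have hPi : PathIn triGraph APi xR t :=
    ((hTRconn q hq).mono subset_union_left).trans (hqt.mono subset_union_right)
  have hxR1 : xR 1 < Y₁ := (hTRbox xR (hTRconn q hq).left_mem).2.2.2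
  -- the seal meets the closed column
  set BL : Set (Site 2) := {z | PathIn triGraph (triStrip aS Y₁ (M - aS).toNat hs ∩ ωᶜ) xβ z} with hBL
  set P3 : Set (Site 2) := {z | PathIn triGraph C₃ g₃ z} with hP3
  obtain ⟨m₃, hm₃P, hm₃B⟩ : ∃ m, m ∈ P3 ∧ m ∈ BL := by
    refine band_meet (L := aS) (R := (M : ℤ)) (b₀ := Y₁) (b₁ := Y₁ + hs) (by omega) (Aξ := BL) (A := P3)
      (fun z hz => ?_) hβ.pathIn_cluster hxβ hyβ (fun z hz => hC₃col z hz.right_mem)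
      hp₃.pathIn_cluster hg₃row (by rw [ht₃1]; exact hY₁N)
    have := mem_triStrip.1 hz.right_mem.1; omega
  obtain ⟨c, b, -, hcf, hb, hbc⟩ := h.exists_botCluster_adj hf₃ hrow
  set BC : Set (Site 2) := {z | PathIn triGraph (↑(rectangle M N) ∩ ωᶜ) c z} with hBC
  -- the row extension to the far right side (strictly right of `R`), at the row of `yβ`
  set Ext : Set (Site 2) := {z | z 1 = yβ 1 ∧ (M : ℤ) + 1 ≤ z 0 ∧ z 0 ≤ M + WR} with hExt
  set cc : Site 2 := yβ + (WR : ℤ) • triE0 with hcc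
  have hcc0 : cc 0 = M + WR := by rw [hcc]; simp [hyβ]
  have hcc1 : cc 1 = yβ 1 := by rw [hcc]; simp
  have hyβB : yβ ∈ BL := hβ
  set ASig : Set (Site 2) := Ext ∪ BL ∪ P3 ∪ {κ f₃} ∪ BC with hASig
  have hSig : PathIn triGraph ASig cc b := by
    have h1 : PathIn triGraph ASig cc yβ := by
      have : PathIn triGraph ASig cc (cc + (WR : ℤ) • -triE0) := by
        refine pathIn_line triGraph_adj_add_neg_triE0 cc WR fun j hj => ?_
        rcases eq_or_lt_of_le hj with heq | hlt
        · have e : cc + ((WR : ℕ) : ℤ) • -triE0 = yβ := by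
            rw [hcc]; ext i; fin_cases i <;> simp
          rw [heq, e]; exact Or.inl (Or.inl (Or.inl (Or.inr hyβB)))
        · refine Or.inl (Or.inl (Or.inl (Or.inl ⟨?_, ?_, ?_⟩)))
          · rw [(ray_neg_triE0_apply _ _).2, hcc1]
          · rw [(ray_neg_triE0_apply _ _).1, hcc0]; omega
          · rw [(ray_neg_triE0_apply _ _).1, hcc0]; omega
      have e : cc + (WR : ℤ) • -triE0 = yβ := by rw [hcc]; ext i; fin_cases i <;> simp
      rwa [e] at this
    have h2 : PathIn triGraph ASig yβ m₃ :=
      (pathIn_cluster_of_mem hyβB hm₃B).mono fun z hz => Or.inl (Or.inl (Or.inl (Or.inr hz)))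
    have h3 : PathIn triGraph ASig m₃ g₃ :=
      (pathIn_cluster_of_mem hm₃P (PathIn.refl hp₃.left_mem)).mono fun z hz => Or.inl (Or.inl (Or.inr hz))
    have h4 : PathIn triGraph ASig g₃ (κ f₃) :=
      PathIn.of_adj (Or.inl (Or.inl (Or.inr (PathIn.refl hp₃.left_mem)))) (Or.inl (Or.inr rfl)) hg₃.symm
    have h5 : PathIn triGraph ASig (κ f₃) c :=
      PathIn.of_adj (Or.inl (Or.inr rfl)) (Or.inr (PathIn.refl hbc.right_mem)) hcf.symm
    exact ((((h1.trans h2).trans h3).trans h4).trans h5).trans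
      ((hbc.symm.pathIn_cluster).mono fun z hz => Or.inr hz)
  have hAPibox : ∀ z ∈ APi, (0 : ℤ) ≤ z 0 ∧ z 0 ≤ M + WR ∧ 0 ≤ z 1 ∧ z 1 ≤ N := by
    rintro z (hz | hz)
    · have := hTRbox z hz; omega
    · have := mem_coe_rectangle.1 (aboveSet_subset_rectangle hz.1); omega
  have hyβs := mem_triStrip.1 hβ.right_mem.1
  have hASigbox : ∀ z ∈ ASig, (0 : ℤ) ≤ z 0 ∧ z 0 ≤ M + WR ∧ 0 ≤ z 1 ∧ z 1 ≤ N := by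
    rintro z ((((⟨h1, h2, h3⟩ | hz) | hz) | hz) | hz)
    · omega
    · have := mem_triStrip.1 hz.right_mem.1; omega
    · have := mem_coe_rectangle.1 (aboveSet_subset_rectangle (hC₃ hz.right_mem).1); omega
    · rw [mem_singleton_iff.1 hz]
      have := mem_coe_rectangle.1 (Finset.mem_coe.2 (h.mem hf₃).2.2); omega
    · have := mem_coe_rectangle.1 hz.right_mem.1; omega
  obtain ⟨z, hzPi, hzSig⟩ := corner_meet_right (L := 0) (R := (M : ℤ) + WR) (B := 0) (T := N) hAPibox
    hASigbox hPi hxR ht1 hSig hcc0 hb (by rw [hcc1]; omega)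
  rcases hzPi with hz | ⟨hzA, hzω⟩
  · rcases hzSig with ((((⟨h1, h2, h3⟩ | hz') | hz') | hz') | hz')
    · have := hTRbox z hz; omega
    · exact hz'.right_mem.2 (hTRω hz)
    · exact (hC₃ hz'.right_mem).2 (hTRω hz)
    · exact hTRexp z hz (mem_singleton_iff.1 hz' ▸ (h.mem hf₃).1)
    · exact hz'.right_mem.2 (hTRω hz)
  · rcases hzSig with ((((⟨h1, h2, h3⟩ | hz') | hz') | hz') | hz')
    · have := mem_coe_rectangle.1 (aboveSet_subset_rectangle hzA); omega
    · exact hz'.right_mem.2 hzω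
    · exact (hC₃ hz'.right_mem).2 hzω
    · exact (mem_rectangle_of_mem_aboveSet hzA).2 (mem_singleton_iff.1 hz' ▸ (h.mem hf₃).1)
    · exact hz'.right_mem.2 hzω

end LowSeq


/-! ### The five arms of the central site -/

/-- **The central five-arm site.** See the module docstring for the construction and the meaning
of the five sets. Hypotheses: the lowest open crossing of `R(M, N)` exists and the explored set has
height `≤ H`; every open left–right-connected set of `R` has height `≥ B₀ ≥ 1` (a closed floor);
three paths off the explored set from the top side land next to it — open (landing column
`[a₁, b₁]`), closed inside the columns `[a₂, b₂] ⊆ [0, b_S]`, closed inside `[a₃, b₃] ⊆ [a_S, M]`;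
two closed seals cross `[0, b_S] × [Y₁, Y₁+h_S]` and `[a_S, M] × [Y₁, Y₁+h_S]`
(`Y₁ = H + h_T + 2`); two open trunks: crossings of `[-W_L, w_L] × [H+1, H+1+h_T]` and
`[M-w_R, M+W_R] × [H+1, H+1+h_T]`, and open paths of `[0, w_L] × [B_V, H+1+h_T]`,
`[M-w_R, M] × [B_V, H+1+h_T]` off the explored set from the top row of these boxes to a
neighbour of the explored set; the trunk columns are at least three columns away from the three
landing columns. [cite: Nolin2008, §5.2, proof of Thm. 24 (ii) (arXiv 0711.4948: Thm. 23 (ii), p. 17)] [cite: WernerPCMI2009, Lecture 6, §3; first exercise sheet, "Five-arm exponent", 3] -/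
theorem exists_centralFiveArms {WL WR wL wR hT hs hV bS : ℕ} {a₁ b₁ a₂ b₂ a₃ b₃ aS BV B₀ : ℤ} {H : ℕ}
    (hB₀ : 1 ≤ B₀) (hHN : (H : ℤ) + hT + 2 + hs ≤ N) (hBV : 0 ≤ BV) (hBV' : BV + hV = (H : ℤ) + 1 + hT)
    (hb₂ : b₂ ≤ bS) (hbSM : (bS : ℤ) ≤ M) (haS : 0 ≤ aS) (haS₃ : aS ≤ a₃)
    (hwL₁ : (wL : ℤ) + 3 ≤ a₁) (hwL₂ : (wL : ℤ) + 3 ≤ a₂) (hwL₃ : (wL : ℤ) + 3 ≤ a₃)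
    (hwR₁ : b₁ + 3 ≤ (M : ℤ) - wR) (hwR₃ : b₃ + 3 ≤ (M : ℤ) - wR)
    (hLR : LRPathIn M N ω) (hH : ∀ e ∈ explored M N ω, e 1 ≤ H)
    (hlow : ∀ (S : Set (Site 2)) (x y : Site 2), S ⊆ (↑(rectangle M N) : Set (Site 2)) ∩ ω →
      x 0 = 0 → y 0 = M → PathIn triGraph S x y → (∀ z ∈ S, PathIn triGraph S x z) → ∀ z ∈ S, B₀ ≤ z 1)
    (hC₁ : ∃ t ∈ topSide M N, ∃ g e : Site 2, e ∈ explored M N ω ∧ triGraph.Adj g e ∧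
      (a₁ ≤ g 0 ∧ g 0 ≤ b₁) ∧ PathIn triGraph ((↑(rectangle M N) \ ↑(explored M N ω)) ∩ ω) t g)
    (hP₂ : ∃ t ∈ topSide M N, ∃ g e : Site 2, e ∈ explored M N ω ∧ triGraph.Adj g e ∧
      PathIn triGraph ((↑(rectangle M N) \ ↑(explored M N ω)) ∩ ({z | a₂ ≤ z 0 ∧ z 0 ≤ b₂} ∩ ωᶜ)) t g)
    (hP₃ : ∃ t ∈ topSide M N, ∃ g e : Site 2, e ∈ explored M N ω ∧ triGraph.Adj g e ∧
      PathIn triGraph ((↑(rectangle M N) \ ↑(explored M N ω)) ∩ ({z | a₃ ≤ z 0 ∧ z 0 ≤ b₃} ∩ ωᶜ)) t g)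
    (hβL : ∃ x y : Site 2, x 0 = 0 ∧ y 0 = bS ∧
      PathIn triGraph (triStrip 0 ((H : ℤ) + hT + 2) bS hs ∩ ωᶜ) x y)
    (hβR : ∃ x y : Site 2, x 0 = aS ∧ y 0 = M ∧
      PathIn triGraph (triStrip aS ((H : ℤ) + hT + 2) ((M : ℤ) - aS).toNat hs ∩ ωᶜ) x y)
    (hHL : ∃ x y : Site 2, x 0 = -(WL : ℤ) ∧ y 0 = wL ∧
      PathIn triGraph (triStrip (-(WL : ℤ)) ((H : ℤ) + 1) (WL + wL) hT ∩ ω) x y)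
    (hVL : ∃ tV g e : Site 2, tV 1 = BV + hV ∧ e ∈ explored M N ω ∧ triGraph.Adj g e ∧
      PathIn triGraph ((triStrip 0 BV wL hV \ ↑(explored M N ω)) ∩ ω) tV g)
    (hHR : ∃ x y : Site 2, x 0 = (M : ℤ) - wR ∧ y 0 = (M : ℤ) + WR ∧
      PathIn triGraph (triStrip ((M : ℤ) - wR) ((H : ℤ) + 1) (wR + WR) hT ∩ ω) x y)
    (hVR : ∃ tV g e : Site 2, tV 1 = BV + hV ∧ e ∈ explored M N ω ∧ triGraph.Adj g e ∧
      PathIn triGraph ((triStrip ((M : ℤ) - wR) BV wR hV \ ↑(explored M N ω)) ∩ ω) tV g) :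
    ∃ v : Site 2, v ∈ explored M N ω ∧ v ∈ ω ∧ B₀ ≤ v 1 ∧
      ∃ SL SR SU SD S5 : Set (Site 2),
        SL ⊆ ω ∧ SR ⊆ ω ∧ S5 ⊆ ω ∧ SU ⊆ ωᶜ ∧ SD ⊆ ωᶜ ∧
        (∀ z ∈ SL ∪ SR ∪ SU ∪ SD ∪ S5, -(WL : ℤ) ≤ z 0 ∧ z 0 ≤ M + WR ∧ 0 ≤ z 1 ∧ z 1 ≤ N) ∧
        (v ∉ SL ∧ v ∉ SR ∧ v ∉ SU ∧ v ∉ SD ∧ v ∉ S5) ∧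
        Disjoint SL SR ∧ Disjoint SU SD ∧ Disjoint S5 (SL ∪ SR) ∧
        (∃ xL ∈ SL, xL 0 = -(WL : ℤ) ∧ (∃ w ∈ SL, triGraph.Adj v w) ∧
          ∀ q ∈ SL, PathIn triGraph SL q xL) ∧
        (∃ xR ∈ SR, xR 0 = (M : ℤ) + WR ∧ (∃ w ∈ SR, triGraph.Adj v w) ∧
          ∀ q ∈ SR, PathIn triGraph SR q xR) ∧
        (∃ tU ∈ SU, tU 1 = N ∧ (∃ w ∈ SU, triGraph.Adj v w) ∧ ∀ q ∈ SU, PathIn triGraph SU q tU) ∧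
        ((∃ w ∈ SD, triGraph.Adj v w) ∧ ∀ q ∈ SD, ∃ b : Site 2, b 1 = 0 ∧ PathIn triGraph SD q b) ∧
        (∃ t5 : Site 2, t5 1 = N ∧ ∃ w ∈ S5, triGraph.Adj v w ∧ PathIn triGraph S5 w t5) := by
  /- the lowest crossing -/
  obtain ⟨x, y, hx0, hyM, hp⟩ := exists_lr_subset_explored hLR
  obtain ⟨n, κ, hκ, hκ0, hκn⟩ := exists_simpleSeq_of_pathIn hp
  have hL : LowSeq M N ω κ n :=
    ⟨hκ.mono fun z hz => ⟨hz.2.2, hz.2.1⟩, Or.inl ⟨by rw [hκ0]; exact hx0, by rw [hκn]; exact hyM⟩⟩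
  have h0 : κ 0 0 = 0 := by rw [hκ0]; exact hx0
  have hn : κ n 0 = M := by rw [hκn]; exact hyM
  have htop : ∀ t ∈ topSide M N, t ∉ explored M N ω := by
    intro t ht htE
    have := hH t htE
    rw [(mem_coe_topSide.1 (Finset.mem_coe.2 ht)).2] at this
    omega
  have hrect : ∀ {k}, k ≤ n → (0 : ℤ) ≤ κ k 0 ∧ κ k 0 ≤ M ∧ (0 : ℤ) ≤ κ k 1 ∧ κ k 1 ≤ N := fun hk =>
    mem_coe_rectangle.1 (Finset.mem_coe.2 (hL.mem hk).2.2)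
  -- the rows of `κ` are at least `B₀`
  have hrows : ∀ k, k ≤ n → B₀ ≤ κ k 1 := by
    set S : Set (Site 2) := {z | ∃ k, k ≤ n ∧ κ k = z} with hS
    have hSsub : S ⊆ (↑(rectangle M N) : Set (Site 2)) ∩ ω := by
      rintro z ⟨k, hk, rfl⟩; exact ⟨Finset.mem_coe.2 (hL.mem hk).2.2, (hL.mem hk).2.1⟩
    have hseg : ∀ k, k ≤ n → PathIn triGraph S (κ 0) (κ k) := fun k hk =>
      hL.seq.pathIn_seg (Nat.zero_le _) hk fun m _ hm => ⟨m, hm.trans hk, rfl⟩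
    intro k hk
    refine hlow S (κ 0) (κ n) hSsub h0 hn (hseg n le_rfl) ?_ (κ k) ⟨k, hk, rfl⟩
    rintro z ⟨m, hm, rfl⟩; exact hseg m hm
  have hrow1 : ∀ k, k ≤ n → 1 ≤ κ k 1 := fun k hk => le_trans hB₀ (hrows k hk)
  /- the three feet -/
  obtain ⟨t₁, ht₁, g₁, e₁, he₁, hge₁, hcol₁, hp₁⟩ := hC₁
  obtain ⟨t₂, ht₂, g₂, e₂, he₂, hge₂, hp₂⟩ := hP₂
  obtain ⟨t₃, ht₃, g₃, e₃, he₃, hge₃, hp₃⟩ := hP₃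
  obtain ⟨f₁, hf₁n, hf₁e, hg₁A, hg₁ω, hq₁⟩ := hL.exists_foot_of_pathIn ω ht₁ he₁ hge₁ hp₁
  obtain ⟨f₂, hf₂n, hf₂e, hg₂A, hg₂C, hq₂⟩ :=
    hL.exists_foot_of_pathIn ({z | a₂ ≤ z 0 ∧ z 0 ≤ b₂} ∩ ωᶜ) ht₂ he₂ hge₂ hp₂
  obtain ⟨f₃, hf₃n, hf₃e, hg₃A, hg₃C, hq₃⟩ :=
    hL.exists_foot_of_pathIn ({z | a₃ ≤ z 0 ∧ z 0 ≤ b₃} ∩ ωᶜ) ht₃ he₃ hge₃ hp₃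
  have ht₁N : t₁ 1 = N := (mem_coe_topSide.1 (Finset.mem_coe.2 ht₁)).2
  have hq₁' : PathIn triGraph (aboveSet M N ω ∩ ω) g₁ t₁ := hq₁
  have hq₃' : PathIn triGraph (aboveSet M N ω ∩ ωᶜ) g₃ t₃ := hq₃.mono fun z hz => ⟨hz.1, hz.2.2⟩
  have hF₁ : IsFootO M N ω κ f₁ := ⟨g₁, hf₁e ▸ hge₁.symm, hg₁A, hg₁ω, t₁, ht₁, hq₁⟩
  have hF₃ : IsFootK M N ω κ f₃ := ⟨g₃, hf₃e ▸ hge₃.symm, hg₃A, hg₃C.2, t₃, ht₃, hq₃'⟩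
  -- rows and columns of the feet
  have hge₁c := triGraph_adj_coord hge₁ 0
  have hge₂c := triGraph_adj_coord hge₂ 0
  have hge₃c := triGraph_adj_coord hge₃ 0
  have hg₂row : g₂ 1 ≤ (H : ℤ) + hT + 2 := by have := triGraph_adj_coord hge₂ 1; have := hH e₂ he₂; omega
  have hg₃row : g₃ 1 ≤ (H : ℤ) + hT + 2 := by have := triGraph_adj_coord hge₃ 1; have := hH e₃ he₃; omega
  /- the double foot -/
  obtain ⟨i, himin, himax, ⟨o, hio, hoA, hoω, t, ht, hot⟩, ⟨u, hiu, huA, huω, t', ht', hut'⟩⟩ :=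
    hL.exists_doubleFoot' htop hf₁n hf₃n hF₁ hF₃
  have hin' : i ≤ n := le_trans himax (max_le hf₁n hf₃n)
  /- the left trunk -/
  obtain ⟨xH, yH, hxH, hyH, hpH⟩ := hHL
  obtain ⟨tV, gL, eL, htV, heL, hgeL, hpV⟩ := hVL
  set VL : Set (Site 2) := {z | PathIn triGraph ((triStrip 0 BV wL hV \ ↑(explored M N ω)) ∩ ω) gL z}
    with hVLdef
  set HLs : Set (Site 2) := {z | PathIn triGraph (triStrip (-(WL : ℤ)) ((H : ℤ) + 1) (WL + wL) hT ∩ ω) xH z}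
    with hHLdef
  set TL : Set (Site 2) := VL ∪ HLs with hTLdef
  have hVboxL : triStrip 0 BV wL hV ⊆ (↑(rectangle M N) : Set (Site 2)) := by
    intro z hz; rw [mem_triStrip] at hz
    exact Finset.mem_coe.2 (mem_rectangle_iff.2 ⟨by omega, by omega, by omega, by omega⟩)
  -- `gL` lies in the region above: back to `tV`, then straight up to the top side
  have hgLA : gL ∈ aboveSet M N ω := by
    have h1 : PathIn triGraph (↑(rectangle M N) \ ↑(explored M N ω)) gL tV :=
      hpV.symm.mono fun z hz => ⟨hVboxL hz.1.1, hz.1.2⟩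
    set LV : ℕ := ((N : ℤ) - (BV + hV)).toNat with hLV
    have hLV' : (LV : ℤ) = N - (BV + hV) := by rw [hLV]; omega
    have htVs := mem_triStrip.1 hpV.left_mem.1.1
    have h2 : PathIn triGraph (↑(rectangle M N) \ ↑(explored M N ω)) tV (tV + (LV : ℤ) • triE1) := by
      refine pathIn_line triGraph_adj_add_triE1 tV LV fun j hj => ⟨?_, fun hE => ?_⟩
      · refine Finset.mem_coe.2 (mem_rectangle_iff.2 ⟨?_, ?_, ?_, ?_⟩) <;> simp <;> omega
      · have := hH _ hE; simp at this; omega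
    have hT : tV + (LV : ℤ) • triE1 ∈ topSide M N := by
      refine Finset.mem_filter.2 ⟨mem_rectangle_iff.2 ⟨?_, ?_, ?_, ?_⟩, ?_⟩ <;> simp <;> omega
    exact mem_aboveSet_of_pathIn (mem_aboveSet_of_pathIn
      (mem_aboveSet_of_mem_topSide hT (htop _ hT)) h2) h1
  obtain ⟨kL, hkLn, hkLe⟩ := hL.exists_eq_of_adj_aboveSet heL hgLA hgeL.symm
  -- the two pieces of the trunk meet
  have hgLrow : gL 1 ≤ (H : ℤ) + 1 := by have := triGraph_adj_coord hgeL 1; have := hH eL heL; omega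
  obtain ⟨mL, hmLV, hmLH⟩ : ∃ m, m ∈ VL ∧ m ∈ HLs := by
    refine band_meet (L := -(WL : ℤ)) (R := (wL : ℤ)) (b₀ := (H : ℤ) + 1) (b₁ := (H : ℤ) + 1 + hT)
      (by omega) (Aξ := HLs) (A := VL) (fun z hz => ?_) hpH.pathIn_cluster hxH hyH (fun z hz => ?_)
      (hpV.symm.pathIn_cluster) hgLrow (by rw [htV, hBV'])
    · have := mem_triStrip.1 hz.right_mem.1; omega
    · have := mem_triStrip.1 hz.right_mem.1.1; omega
  have hTLω : TL ⊆ ω := by rintro z (hz | hz); exacts [hz.right_mem.2, hz.right_mem.2]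
  have hTLbox : ∀ z ∈ TL, -(WL : ℤ) ≤ z 0 ∧ z 0 ≤ M ∧ 0 ≤ z 1 ∧ z 1 < (H : ℤ) + hT + 2 := by
    rintro z (hz | hz)
    · have := mem_triStrip.1 hz.right_mem.1.1; omega
    · have := mem_triStrip.1 hz.right_mem.1; omega
  have hTLbox' : ∀ z ∈ TL, -(WL : ℤ) ≤ z 0 ∧ z 0 ≤ M ∧ 0 ≤ z 1 ∧ z 1 ≤ N := fun z hz => by
    have := hTLbox z hz; omega
  have hTLx : ∀ z ∈ TL, z 0 ≤ wL := by
    rintro z (hz | hz)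
    · have := mem_triStrip.1 hz.right_mem.1.1; omega
    · have := mem_triStrip.1 hz.right_mem.1; omega
  have hTLexp : ∀ z ∈ TL, z ∉ explored M N ω := by
    rintro z (hz | hz) hzE
    · exact hz.right_mem.1.2 hzE
    · have := mem_triStrip.1 hz.right_mem.1; have := hH z hzE; omega
  have hxHT : xH ∈ TL := Or.inr (PathIn.refl hpH.left_mem)
  have hgLT : gL ∈ TL := Or.inl (PathIn.refl hpV.right_mem)
  have hTLconn : ∀ q ∈ TL, PathIn triGraph TL xH q := by
    rintro q (hq | hq)
    · exact ((PathIn.pathIn_cluster hmLH).mono subset_union_right).trans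
        ((pathIn_cluster_of_mem hmLV hq).mono subset_union_left)
    · exact (PathIn.pathIn_cluster hq).mono subset_union_right
  -- the left seal
  obtain ⟨xβ, yβ, hxβ, hyβ, hβ⟩ := hβL
  have hsealL : ∀ q ∈ TL, ∀ t ∈ topSide M N, ¬ PathIn triGraph (aboveSet M N ω ∩ ω) q t :=
    hL.seal_left (by positivity) hHN hxβ hyβ hβ hbSM hf₂n (hrow1 f₂ hf₂n) (hf₂e ▸ hge₂.symm) hg₂row ht₂
      (C₂ := aboveSet M N ω ∩ ({z | a₂ ≤ z 0 ∧ z 0 ≤ b₂} ∩ ωᶜ)) (fun z hz => ⟨hz.1, hz.2.2⟩)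
      (fun z hz => by have := hz.2.1; simp only [mem_setOf_eq] at this; omega) hq₂ hTLbox hTLexp hTLω hxH
      hTLconn
  -- the left trunk lands strictly before the feet `f₁`, `f₃`
  have hkL₁ : kL < f₁ := by
    have hle : kL ≤ f₁ :=
      hL.trunk_index_le hn hTLbox' hTLexp hTLω hxH (hTLconn gL hgLT) hkLn (hkLe ▸ hgeL) hf₁n
        (hrow1 f₁ hf₁n) (hf₁e ▸ hge₁.symm) ht₁ (Cf := {z | PathIn triGraph (aboveSet M N ω ∩ ω) g₁ z})
        (fun z hz => hz.right_mem.1) hq₁'.pathIn_cluster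
        (fun z hz hzC => hsealL z hz t₁ ht₁ (hzC.symm.trans hq₁'))
    refine lt_of_le_of_ne hle fun heq => ?_
    have hE : eL = e₁ := by rw [← hkLe, ← hf₁e, heq]
    have hgLx := hTLx gL hgLT
    have hc := triGraph_adj_coord hgeL 0
    rw [hE] at hc
    omega
  have hkL₃ : kL < f₃ := by
    have hle : kL ≤ f₃ :=
      hL.trunk_index_le hn hTLbox' hTLexp hTLω hxH (hTLconn gL hgLT) hkLn (hkLe ▸ hgeL) hf₃n
        (hrow1 f₃ hf₃n) (hf₃e ▸ hge₃.symm) ht₃ (Cf := aboveSet M N ω ∩ ({z | a₃ ≤ z 0 ∧ z 0 ≤ b₃} ∩ ωᶜ))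
        (fun z hz => hz.1) hq₃ (fun z hz hzC => hzC.2.2 (hTLω hz))
    refine lt_of_le_of_ne hle fun heq => ?_
    have hE : eL = e₃ := by rw [← hkLe, ← hf₃e, heq]
    have hgLx := hTLx gL hgLT
    have hc := triGraph_adj_coord hgeL 0
    have h3 : a₃ ≤ g₃ 0 ∧ g₃ 0 ≤ b₃ := hg₃C.1
    rw [hE] at hc
    omega
  have hkLi : kL < i := lt_of_lt_of_le (lt_min hkL₁ hkL₃) himin
  /- the right trunk -/
  obtain ⟨xK, yK, hxK, hyK, hpK⟩ := hHR
  obtain ⟨tW, gR, eR, htW, heR, hgeR, hpW⟩ := hVR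
  set VR : Set (Site 2) :=
    {z | PathIn triGraph ((triStrip ((M : ℤ) - wR) BV wR hV \ ↑(explored M N ω)) ∩ ω) gR z} with hVRdef
  set HRs : Set (Site 2) :=
    {z | PathIn triGraph (triStrip ((M : ℤ) - wR) ((H : ℤ) + 1) (wR + WR) hT ∩ ω) yK z} with hHRdef
  set TR : Set (Site 2) := VR ∪ HRs with hTRdef
  have hVboxR : triStrip ((M : ℤ) - wR) BV wR hV ⊆ (↑(rectangle M N) : Set (Site 2)) := by
    intro z hz; rw [mem_triStrip] at hz
    exact Finset.mem_coe.2 (mem_rectangle_iff.2 ⟨by omega, by omega, by omega, by omega⟩)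
  have hgRA : gR ∈ aboveSet M N ω := by
    have h1 : PathIn triGraph (↑(rectangle M N) \ ↑(explored M N ω)) gR tW :=
      hpW.symm.mono fun z hz => ⟨hVboxR hz.1.1, hz.1.2⟩
    set LV : ℕ := ((N : ℤ) - (BV + hV)).toNat with hLV
    have hLV' : (LV : ℤ) = N - (BV + hV) := by rw [hLV]; omega
    have htWs := mem_triStrip.1 hpW.left_mem.1.1
    have h2 : PathIn triGraph (↑(rectangle M N) \ ↑(explored M N ω)) tW (tW + (LV : ℤ) • triE1) := by
      refine pathIn_line triGraph_adj_add_triE1 tW LV fun j hj => ⟨?_, fun hE => ?_⟩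
      · refine Finset.mem_coe.2 (mem_rectangle_iff.2 ⟨?_, ?_, ?_, ?_⟩) <;> simp <;> omega
      · have := hH _ hE; simp at this; omega
    have hT : tW + (LV : ℤ) • triE1 ∈ topSide M N := by
      refine Finset.mem_filter.2 ⟨mem_rectangle_iff.2 ⟨?_, ?_, ?_, ?_⟩, ?_⟩ <;> simp <;> omega
    exact mem_aboveSet_of_pathIn (mem_aboveSet_of_pathIn
      (mem_aboveSet_of_mem_topSide hT (htop _ hT)) h2) h1
  obtain ⟨kR, hkRn, hkRe⟩ := hL.exists_eq_of_adj_aboveSet heR hgRA hgeR.symm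
  have hgRrow : gR 1 ≤ (H : ℤ) + 1 := by have := triGraph_adj_coord hgeR 1; have := hH eR heR; omega
  have hKpath : PathIn triGraph HRs xK yK := pathIn_cluster_of_mem hpK.symm (PathIn.refl hpK.right_mem)
  obtain ⟨mR, hmRV, hmRH⟩ : ∃ m, m ∈ VR ∧ m ∈ HRs := by
    refine band_meet (L := (M : ℤ) - wR) (R := (M : ℤ) + WR) (b₀ := (H : ℤ) + 1) (b₁ := (H : ℤ) + 1 + hT)
      (by omega) (Aξ := HRs) (A := VR) (fun z hz => ?_) hKpath hxK hyK (fun z hz => ?_)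
      (hpW.symm.pathIn_cluster) hgRrow (by rw [htW, hBV'])
    · have := mem_triStrip.1 hz.right_mem.1; omega
    · have := mem_triStrip.1 hz.right_mem.1.1; omega
  have hTRω : TR ⊆ ω := by rintro z (hz | hz); exacts [hz.right_mem.2, hz.right_mem.2]
  have hTRbox : ∀ z ∈ TR, (0 : ℤ) ≤ z 0 ∧ z 0 ≤ M + WR ∧ 0 ≤ z 1 ∧ z 1 < (H : ℤ) + hT + 2 := by
    rintro z (hz | hz)
    · have := mem_triStrip.1 hz.right_mem.1.1; omega
    · have := mem_triStrip.1 hz.right_mem.1; omega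
  have hTRbox' : ∀ z ∈ TR, (0 : ℤ) ≤ z 0 ∧ z 0 ≤ M + WR ∧ 0 ≤ z 1 ∧ z 1 ≤ N := fun z hz => by
    have := hTRbox z hz; omega
  have hTRx : ∀ z ∈ TR, (M : ℤ) - wR ≤ z 0 := by
    rintro z (hz | hz)
    · have := mem_triStrip.1 hz.right_mem.1.1; omega
    · have := mem_triStrip.1 hz.right_mem.1; omega
  have hTRexp : ∀ z ∈ TR, z ∉ explored M N ω := by
    rintro z (hz | hz) hzE
    · exact hz.right_mem.1.2 hzE
    · have := mem_triStrip.1 hz.right_mem.1; have := hH z hzE; omega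
  have hyKT : yK ∈ TR := Or.inr (PathIn.refl hpK.right_mem)
  have hgRT : gR ∈ TR := Or.inl (PathIn.refl hpW.right_mem)
  have hTRconn : ∀ q ∈ TR, PathIn triGraph TR yK q := by
    rintro q (hq | hq)
    · exact ((PathIn.pathIn_cluster hmRH).mono subset_union_right).trans
        ((pathIn_cluster_of_mem hmRV hq).mono subset_union_left)
    · exact (PathIn.pathIn_cluster hq).mono subset_union_right
  -- the right seal
  obtain ⟨xγ, yγ, hxγ, hyγ, hγ⟩ := hβR
  have h3col : a₃ ≤ g₃ 0 ∧ g₃ 0 ≤ b₃ := hg₃C.1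
  have hsealR : ∀ q ∈ TR, ∀ t ∈ topSide M N, ¬ PathIn triGraph (aboveSet M N ω ∩ ω) q t :=
    hL.seal_right (by positivity) hHN haS (by omega) hxγ hyγ hγ hf₃n (hrow1 f₃ hf₃n) (hf₃e ▸ hge₃.symm)
      hg₃row ht₃ (C₃ := aboveSet M N ω ∩ ({z | a₃ ≤ z 0 ∧ z 0 ≤ b₃} ∩ ωᶜ)) (fun z hz => ⟨hz.1, hz.2.2⟩)
      (fun z hz => by
        have h1 : a₃ ≤ z 0 ∧ z 0 ≤ b₃ := hz.2.1
        have := mem_coe_rectangle.1 (LowSeq.aboveSet_subset_rectangle hz.1); omega)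
      hq₃ hTRbox hTRexp hTRω hyK hTRconn
  -- the right trunk lands strictly after the feet `f₁`, `f₃`
  have hkR₁ : f₁ < kR := by
    have hle : f₁ ≤ kR :=
      hL.trunk_index_ge h0 hTRbox' hTRexp hTRω hyK (hTRconn gR hgRT) hkRn (hkRe ▸ hgeR) hf₁n
        (hrow1 f₁ hf₁n) (hf₁e ▸ hge₁.symm) ht₁ (Cf := {z | PathIn triGraph (aboveSet M N ω ∩ ω) g₁ z})
        (fun z hz => hz.right_mem.1) hq₁'.pathIn_cluster
        (fun z hz hzC => hsealR z hz t₁ ht₁ (hzC.symm.trans hq₁'))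
    refine lt_of_le_of_ne hle fun heq => ?_
    have hE : e₁ = eR := by rw [← hkRe, ← hf₁e, heq]
    have hgRx := hTRx gR hgRT
    have hc := triGraph_adj_coord hgeR 0
    rw [← hE] at hc
    omega
  have hkR₃ : f₃ < kR := by
    have hle : f₃ ≤ kR :=
      hL.trunk_index_ge h0 hTRbox' hTRexp hTRω hyK (hTRconn gR hgRT) hkRn (hkRe ▸ hgeR) hf₃n
        (hrow1 f₃ hf₃n) (hf₃e ▸ hge₃.symm) ht₃ (Cf := aboveSet M N ω ∩ ({z | a₃ ≤ z 0 ∧ z 0 ≤ b₃} ∩ ωᶜ))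
        (fun z hz => hz.1) hq₃ (fun z hz hzC => hzC.2.2 (hTRω hz))
    refine lt_of_le_of_ne hle fun heq => ?_
    have hE : e₃ = eR := by rw [← hkRe, ← hf₃e, heq]
    have hgRx := hTRx gR hgRT
    have hc := triGraph_adj_coord hgeR 0
    have h3 : a₃ ≤ g₃ 0 ∧ g₃ 0 ≤ b₃ := hg₃C.1
    rw [← hE] at hc
    omega
  have hikR : i < kR := lt_of_le_of_lt himax (max_lt hkR₁ hkR₃)
  /- the site `v = κ i` and the closed cluster below it -/
  have hi1 : 1 ≤ i := by omega
  have hin : i + 1 ≤ n := by omega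
  have hv := hL.mem hin'
  obtain ⟨c, b, hc, hci, hb, hbc⟩ := hL.exists_botCluster_adj hin' (hrow1 i hin')
  /- the five sets -/
  set S₀ : Set (Site 2) := {z | ∃ k, k ≤ n ∧ k < i ∧ κ k = z} with hS₀def
  set S₁ : Set (Site 2) := {z | ∃ k, k ≤ n ∧ i < k ∧ κ k = z} with hS₁def
  set SU : Set (Site 2) := {z | PathIn triGraph (aboveSet M N ω ∩ ωᶜ) u z} with hSUdef
  set SD : Set (Site 2) := {z | PathIn triGraph (↑(rectangle M N) ∩ ωᶜ) c z} with hSDdef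
  set S5 : Set (Site 2) := {z | PathIn triGraph (aboveSet M N ω ∩ ω) o z} with hS5def
  have hS₀sub : S₀ ⊆ ↑(explored M N ω) ∩ ω := by rintro z ⟨k, hk, -, rfl⟩; exact ⟨(hL.mem hk).1, (hL.mem hk).2.1⟩
  have hS₁sub : S₁ ⊆ ↑(explored M N ω) ∩ ω := by rintro z ⟨k, hk, -, rfl⟩; exact ⟨(hL.mem hk).1, (hL.mem hk).2.1⟩
  have hSDsub : SD ⊆ ↑(explored M N ω) ∩ ωᶜ := fun z hz =>
    ⟨botCluster_subset_explored (mem_botCluster.2 ⟨b, by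
      exact Finset.mem_filter.2 ⟨mem_rectangle_iff.2 (by
        have := mem_coe_rectangle.1 hbc.left_mem.1; omega), hb⟩, hbc.trans hz⟩), hz.right_mem.2⟩
  have hexpA : ∀ {z}, z ∈ (↑(explored M N ω) : Set (Site 2)) → z ∉ aboveSet M N ω := fun hz hzA =>
    (mem_rectangle_of_mem_aboveSet hzA).2 hz
  have ht'N : t' 1 = N := (mem_coe_topSide.1 (Finset.mem_coe.2 ht')).2
  have htN : t 1 = N := (mem_coe_topSide.1 (Finset.mem_coe.2 ht)).2
  refine ⟨κ i, hv.1, hv.2.1, hrows i hin', S₀ ∪ TL, S₁ ∪ TR, SU, SD, S5,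
    union_subset (fun z hz => (hS₀sub hz).2) hTLω, union_subset (fun z hz => (hS₁sub hz).2) hTRω,
    fun z hz => hz.right_mem.2, fun z hz => hz.right_mem.2, fun z hz => (hSDsub hz).2, ?_, ?_, ?_, ?_, ?_, ?_,
    ?_, ?_, ?_, ?_⟩
  · -- the arena
    have hR : ∀ z ∈ (↑(rectangle M N) : Set (Site 2)), -(WL : ℤ) ≤ z 0 ∧ z 0 ≤ M + WR ∧ 0 ≤ z 1 ∧ z 1 ≤ N :=
      fun z hz => by have := mem_coe_rectangle.1 hz; omega
    rintro z ((((hz | hz) | hz) | hz) | hz)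
    · rcases hz with hz | hz
      · exact hR z (explored_subset ω (hS₀sub hz).1)
      · have := hTLbox' z hz; omega
    · rcases hz with hz | hz
      · exact hR z (explored_subset ω (hS₁sub hz).1)
      · have := hTRbox' z hz; omega
    · exact hR z (LowSeq.aboveSet_subset_rectangle hz.right_mem.1)
    · exact hR z hz.right_mem.1
    · exact hR z (LowSeq.aboveSet_subset_rectangle hz.right_mem.1)
  · -- `v` is off the five sets
    refine ⟨?_, ?_, fun hz => hz.right_mem.2 hv.2.1, fun hz => (hSDsub hz).2 hv.2.1, fun hz => hexpA hv.1 hz.right_mem.1⟩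
    · rintro (⟨k, hk, hki, hkv⟩ | hz)
      · have := hL.seq.inj k i hk hin' hkv; omega
      · exact hTLexp _ hz hv.1
    · rintro (⟨k, hk, hki, hkv⟩ | hz)
      · have := hL.seq.inj k i hk hin' hkv; omega
      · exact hTRexp _ hz hv.1
  · -- `S_L ∩ S_R = ∅`
    rw [Set.disjoint_left]
    rintro z (⟨k, hk, hki, rfl⟩ | hz) (⟨l, hl, hil, hkl⟩ | hz')
    · have := hL.seq.inj l k hl hk hkl; omega
    · exact hTRexp _ hz' (hL.mem hk).1
    · exact hTLexp _ hz (hkl ▸ (hL.mem hl).1)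
    · have := hTLx z hz; have := hTRx z hz'; omega
  · -- `S_U ∩ S_D = ∅`
    rw [Set.disjoint_left]
    intro z hz hz'
    exact hexpA (hSDsub hz').1 hz.right_mem.1
  · -- `S_5 ∩ (S_L ∪ S_R) = ∅`
    rw [Set.disjoint_left]
    rintro z hz ((hz' | hz') | (hz' | hz'))
    · exact hexpA (hS₀sub hz').1 hz.right_mem.1
    · exact hsealL z hz' t ht (hz.symm.trans hot)
    · exact hexpA (hS₁sub hz').1 hz.right_mem.1
    · exact hsealR z hz' t ht (hz.symm.trans hot)
  · -- the left arm
    have hadj : triGraph.Adj (κ i) (κ (i - 1)) := by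
      have := hL.seq.adj (i - 1) (by omega)
      rw [Nat.sub_add_cancel hi1] at this
      exact this.symm
    have hseg0 : ∀ k, k ≤ n → k < i → PathIn triGraph S₀ (κ 0) (κ k) := fun k hk hki =>
      hL.seq.pathIn_seg (Nat.zero_le _) hk fun m _ hm => ⟨m, hm.trans hk, lt_of_le_of_lt hm hki, rfl⟩
    refine ⟨xH, Or.inr hxHT, hxH, ⟨κ (i - 1), Or.inl ⟨i - 1, by omega, by omega, rfl⟩, hadj⟩, ?_⟩
    have hgLx : PathIn triGraph (S₀ ∪ TL) gL xH := (hTLconn gL hgLT).symm.mono subset_union_right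
    rintro q (⟨k, hk, hki, rfl⟩ | hq)
    · have h1 : PathIn triGraph (S₀ ∪ TL) (κ k) (κ kL) :=
        ((hseg0 k hk hki).symm.trans (hseg0 kL hkLn hkLi)).mono subset_union_left
      have h2 : PathIn triGraph (S₀ ∪ TL) (κ kL) gL :=
        PathIn.of_adj (Or.inl ⟨kL, hkLn, hkLi, rfl⟩) (Or.inr hgLT) (hkLe ▸ hgeL.symm)
      exact (h1.trans h2).trans hgLx
    · exact (hTLconn q hq).symm.mono subset_union_right
  · -- the right arm
    have hsegn : ∀ k, k ≤ n → i < k → PathIn triGraph S₁ (κ k) (κ n) := fun k hk hik =>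
      hL.seq.pathIn_seg hk le_rfl fun m hm hmn => ⟨m, hmn, lt_of_lt_of_le hik hm, rfl⟩
    refine ⟨yK, Or.inr hyKT, hyK, ⟨κ (i + 1), Or.inl ⟨i + 1, hin, Nat.lt_succ_self i, rfl⟩, hL.seq.adj i hin⟩, ?_⟩
    have hgRx : PathIn triGraph (S₁ ∪ TR) gR yK := (hTRconn gR hgRT).symm.mono subset_union_right
    rintro q (⟨k, hk, hik, rfl⟩ | hq)
    · have h1 : PathIn triGraph (S₁ ∪ TR) (κ k) (κ kR) :=
        ((hsegn k hk hik).trans (hsegn kR hkRn hikR).symm).mono subset_union_left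
      have h2 : PathIn triGraph (S₁ ∪ TR) (κ kR) gR :=
        PathIn.of_adj (Or.inl ⟨kR, hkRn, hikR, rfl⟩) (Or.inr hgRT) (hkRe ▸ hgeR.symm)
      exact (h1.trans h2).trans hgRx
    · exact (hTRconn q hq).symm.mono subset_union_right
  · -- the closed arm to the top side
    exact ⟨t', hut', ht'N, ⟨u, PathIn.refl hut'.left_mem, hiu⟩, fun q hq => pathIn_cluster_of_mem hq hut'⟩
  · -- the closed arm below
    exact ⟨⟨c, PathIn.refl hbc.right_mem, hci.symm⟩, fun q hq => ⟨b, hb, pathIn_cluster_of_mem hq hbc.symm⟩⟩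
  · -- the open arm to the top side
    exact ⟨t, htN, o, PathIn.refl hot.left_mem, hio, hot.pathIn_cluster⟩

end Literature.Probability.Percolation
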